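import Mathlib
import HarnessLib
import Summits.HubbardSuperconductivity.HubbardSuperconductivity.Theorems.KLProgrammeKLRegimeEngineTowerNumericsDoors

/-!
# Route `KLProgramme` — crux K3 ENGINE (stmt-HubbardSuperconductivity-20437 `KLRegimeEngineV17F2`), stub (b) v2, THE LEVELS PACKAGE (ℓ), instantiation (I5)-LEV:
# THE NUMERICS OF THE LEVELLED TOWER LAW — explicit `(Q′, Q, A′, A, ι₃)` meeting EVERY floor and EVERY numerical side condition of
# `klTowerBLev_le_law_of_inputs_scaled_disc` from the blocking row, two amplitude rows in `B`, and `λ ≤ λ₀` (or the two doors)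
# (cell gate-hubbard-kl, seat hubbard-kl-k3c3-p2 g14, located «(I5)-LEV» / «(I5)-UV-DISCOUNT»; E1-LEVELS-BLUEPRINT-g8 §3 (I5), E1-TOWER-BLOCKED §9 (i)–(iv):
#  order of choices d → Q → B → ε; E1's (I5) by the substitute precedent — E1 may rename or supersede)

The levelled law `klTowerBLev_le_law_of_inputs_scaled_disc` (…LevLawOfInputsScaledDisc) carries, besides the model inputs (step constants `σ Φ ψ τ`, unit prefactors
`W Z`, imports `ι₁ ι₂`, cell `X`, UV datum `Qe.CE` at `ε_x = imagTimeWeight β M`, re-measurement constants `C₁ C₂`, block length `d`, discount `B`), the FLOORS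
`W·27⁵ε_x/B² ≤ A′`, `W·27⁵(C₁/C₂)8^{d−1}(ε_x/B² + A/(1−(√2^d)⁻¹)) ≤ A′`, `Z·CE/ε_x² ≤ Q′`, `Z·C₂²(2^{d−1})⁻¹·max Q (CE/ε_x²) ≤ Q′`, `0 < Q′`, `W·Z³·X ≤ ι₃`,
`A′Q′³ ≤ ι₃` and the kit's eight numerics `hx₁ hx₂ hx₃ hy hθ hu₁ hu₂ hclose`.  This file DISCHARGES all of them by the explicit choices (equational binders, instantiate with `rfl`)

  `ρ = max 4 (2τψ)`, `Q′ = Z·(CE/ε²) + 1`, `Q = ρ·Q′`, `ĉ = 1 + (C₁/C₂)·8^{d−1}`,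
  `Y = ι₂/(2Q′) + W·Z³·X/(4Q′²) + W·27⁵·(ε/B²)·ĉ·Q′/2`   (the λ-free amplitude: imports + cell + discounted UV),
  `A = 2·Y·(1 − (√2^d)⁻¹)/(W·27⁵·ĉ·Q′)`, `A′ = W·27⁵·(ε/B²)·ĉ + 2Y/Q′`, `ι₃ = W·Z³·X + A′·Q′³`,

from THREE closed-form rows: the BLOCKING row `max 1 Z · C₂² · max 4 (2τψ) ≤ 2^{d−1}` (choice of `d`) and the two AMPLITUDE rows `8·Φ·τ·Y ≤ 1`,
`128·e·ψ³·τ⁴·Φ·(W·27⁵·ĉ)·Y ≤ (1 − (√2^d)⁻¹)·ρ³` (choice of `B`: at `λ = B·ε` the imports/cell scale `ι₂ ∝ 1/B`, `X ∝ 1/B²` and the UV term is `∝ 1/B²`,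
so `Y → 0` as `B → ∞`) — `towerLevNumerics_rows` (§2: positivity, floors, `hu₁ hu₂`, `(N1) (N2)` with `Y₀ = 2Y`); then the six λ-rows from `λ ≤ λ₀` by the
generic (I5) core `towerNumerics_side_of_lam_le` (…EngineTowerNumerics) — `towerLevNumerics_side_of_lam_le` (§3) — or from the U-door/c-door in the KL regime at
`λ := B·epsCoupling P U j` by `towerNumerics_side_of_doors` (…TowerNumericsDoors) — `towerLevNumerics_side_of_doors` (§3).
Pure real arithmetic; nothing about the model is asserted; nothing asserts (ℓ), any stub, K3 or superconductivity.
References: Benfatto–Giuliani–Mastropietro 2006 §2.8 (2.83), (2.93)–(2.98) [cite: BenfattoGiulianiMastropietro2006]; Gawȩdzki–Kupiainen 1985 §3.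
-/

noncomputable section

namespace Summit.HubbardSuperconductivity.HubbardSuperconductivity.Theorems.EngineV8

set_option linter.dupNamespace false -- summit = problem name (single-conjunct summit), D-0017

open Real Literature.MathematicalPhysics.QuantumLattice
open Summit.HubbardSuperconductivity.HubbardSuperconductivity.Theorems.KLRegimeSplit
open Summit.HubbardSuperconductivity.HubbardSuperconductivity.Theorems.DispersionFlow

/-! ## §1 Two elementary facts -/

/-- `0 < 1 − (√2^d)⁻¹` for `d ≥ 1`. [folklore] -/
theorem one_sub_inv_sqrt_two_pow_pos {d : ℕ} (hd : 1 ≤ d) : 0 < 1 - (Real.sqrt 2 ^ d)⁻¹ := by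
  have hs1 : 1 < Real.sqrt 2 := by
    rw [show (1 : ℝ) = Real.sqrt 1 by simp]
    exact Real.sqrt_lt_sqrt (by norm_num) (by norm_num)
  have : (1 : ℝ) < Real.sqrt 2 ^ d := one_lt_pow₀ hs1 (by omega)
  exact sub_pos.2 (inv_lt_one_of_one_lt₀ this)

/-- `4 ≤ max 4 (2τψ)` and `2τψ ≤ max 4 (2τψ)`. [folklore] -/
theorem towerLevNumerics_rho_ge (τ ψ : ℝ) : 4 ≤ max 4 (2 * τ * ψ) ∧ 2 * τ * ψ ≤ max 4 (2 * τ * ψ) :=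
  ⟨le_max_left _ _, le_max_right _ _⟩

/-! ## §2 The rows: positivity, the floors, the blocking consequences, the amplitude rows `(N1) (N2)` -/

section Rows

variable {σ Φ ψ τ W Z C₁ C₂ ε CE B ι₂ X ρ Q' Q ĉ Y A A' ι₃ : ℝ} {d : ℕ}

/-- `1 ≤ Q′` for `Q′ = Z·(CE/ε²) + 1`. -/
theorem towerLevNumerics_one_le_Q' (hZ : 0 < Z) (hε : 0 < ε) (hCE : 0 ≤ CE) (hQ' : Q' = Z * (CE / ε ^ 2) + 1) : 1 ≤ Q' := by
  have : 0 ≤ Z * (CE / ε ^ 2) := by positivity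
  rw [hQ']; linarith

/-- `1 ≤ ĉ` and `(C₁/C₂)·8^{d−1} ≤ ĉ` for `ĉ = 1 + (C₁/C₂)·8^{d−1}`. -/
theorem towerLevNumerics_chat (hC₁ : 0 < C₁) (hC₂ : 0 < C₂) (hĉ : ĉ = 1 + C₁ / C₂ * (8 : ℝ) ^ (d - 1)) :
    1 ≤ ĉ ∧ C₁ / C₂ * (8 : ℝ) ^ (d - 1) ≤ ĉ := by
  have : 0 ≤ C₁ / C₂ * (8 : ℝ) ^ (d - 1) := by positivity
  rw [hĉ]; constructor <;> linarith

/-- **Positivity**: `0 < Y` (it contains the discounted UV term), hence `0 < A`, `0 ≤ A′`, `0 ≤ ι₃`, `0 < Q′`, `0 < Q`, `0 < A·Q³`. -/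
theorem towerLevNumerics_pos
    (hW : 0 < W) (hZ : 0 < Z) (hC₁ : 0 < C₁) (hC₂ : 0 < C₂) (hd : 2 ≤ d)
    (hε : 0 < ε) (hCE : 0 ≤ CE) (hB : 1 ≤ B) (hι₂ : 0 ≤ ι₂) (hX : 0 ≤ X)
    (hρ : ρ = max 4 (2 * τ * ψ)) (hQ' : Q' = Z * (CE / ε ^ 2) + 1) (hQ : Q = ρ * Q') (hĉ : ĉ = 1 + C₁ / C₂ * (8 : ℝ) ^ (d - 1))
    (hY : Y = ι₂ / (2 * Q') + W * Z ^ 3 * X / (4 * Q' ^ 2) + W * ((27 : ℝ) ^ 5 * (ε / B ^ 2)) * ĉ * Q' / 2)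
    (hA : A = 2 * Y * (1 - (Real.sqrt 2 ^ d)⁻¹) / (W * (27 : ℝ) ^ 5 * ĉ * Q'))
    (hA' : A' = W * ((27 : ℝ) ^ 5 * (ε / B ^ 2)) * ĉ + 2 * Y / Q') (hι₃ : ι₃ = W * Z ^ 3 * X + A' * Q' ^ 3) :
    0 < Y ∧ 0 < Q' ∧ 0 < Q ∧ 0 < A ∧ 0 ≤ A' ∧ 0 ≤ ι₃ ∧ 0 < A * Q ^ 3 := by
  have hr : 0 < 1 - (Real.sqrt 2 ^ d)⁻¹ := one_sub_inv_sqrt_two_pow_pos (by omega)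
  have hρ0 : 0 < ρ := by rw [hρ]; exact lt_of_lt_of_le (by norm_num) (le_max_left _ _)
  have hB0 : 0 < B := lt_of_lt_of_le one_pos hB
  have hQ'0 : 0 < Q' := lt_of_lt_of_le one_pos (towerLevNumerics_one_le_Q' hZ hε hCE hQ')
  have hQ0 : 0 < Q := by rw [hQ]; positivity
  have hĉ0 : 0 < ĉ := lt_of_lt_of_le one_pos (towerLevNumerics_chat hC₁ hC₂ hĉ (d := d)).1
  have hY0 : 0 < Y := by
    have h1 : 0 ≤ ι₂ / (2 * Q') := by positivity
    have h2 : 0 ≤ W * Z ^ 3 * X / (4 * Q' ^ 2) := by positivity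
    have h3 : 0 < W * ((27 : ℝ) ^ 5 * (ε / B ^ 2)) * ĉ * Q' / 2 := by positivity
    rw [hY]; linarith
  have hA0 : 0 < A := by rw [hA]; positivity
  have hA'0 : 0 ≤ A' := by rw [hA']; positivity
  have hι₃0 : 0 ≤ ι₃ := by rw [hι₃]; positivity
  exact ⟨hY0, hQ'0, hQ0, hA0, hA'0, hι₃0, by positivity⟩

/-- **The `A′`-floors**: `W·27⁵·ε/B² ≤ A′` and `W·27⁵(C₁/C₂)8^{d−1}(ε/B² + A/(1−(√2^d)⁻¹)) ≤ A′` (the second is an equality at the constant `ĉ`). -/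
theorem towerLevNumerics_floorsA
    (hW : 0 < W) (hZ : 0 < Z) (hC₁ : 0 < C₁) (hC₂ : 0 < C₂) (hd : 2 ≤ d)
    (hε : 0 < ε) (hCE : 0 ≤ CE) (hB : 1 ≤ B) (hι₂ : 0 ≤ ι₂) (hX : 0 ≤ X)
    (hρ : ρ = max 4 (2 * τ * ψ)) (hQ' : Q' = Z * (CE / ε ^ 2) + 1) (hQ : Q = ρ * Q') (hĉ : ĉ = 1 + C₁ / C₂ * (8 : ℝ) ^ (d - 1))
    (hY : Y = ι₂ / (2 * Q') + W * Z ^ 3 * X / (4 * Q' ^ 2) + W * ((27 : ℝ) ^ 5 * (ε / B ^ 2)) * ĉ * Q' / 2)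
    (hA : A = 2 * Y * (1 - (Real.sqrt 2 ^ d)⁻¹) / (W * (27 : ℝ) ^ 5 * ĉ * Q'))
    (hA' : A' = W * ((27 : ℝ) ^ 5 * (ε / B ^ 2)) * ĉ + 2 * Y / Q') (hι₃ : ι₃ = W * Z ^ 3 * X + A' * Q' ^ 3) :
    W * ((27 : ℝ) ^ 5 * (ε / B ^ 2)) ≤ A' ∧
      W * ((27 : ℝ) ^ 5 * (C₁ / C₂) * (8 : ℝ) ^ (d - 1) * (ε / B ^ 2 + A / (1 - (Real.sqrt 2 ^ d)⁻¹))) ≤ A' := by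
  obtain ⟨hY0, hQ'0, _, hA0, _, _, _⟩ := towerLevNumerics_pos hW hZ hC₁ hC₂ hd hε hCE hB hι₂ hX hρ hQ' hQ hĉ hY hA hA' hι₃
  have hr : 0 < 1 - (Real.sqrt 2 ^ d)⁻¹ := one_sub_inv_sqrt_two_pow_pos (by omega)
  have hB0 : 0 < B := lt_of_lt_of_le one_pos hB
  obtain ⟨hĉ1, hĉge⟩ := towerLevNumerics_chat hC₁ hC₂ hĉ (d := d)
  have hĉ0 : 0 < ĉ := lt_of_lt_of_le one_pos hĉ1
  constructor
  · rw [hA']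
    have h2 : 0 ≤ 2 * Y / Q' := by positivity
    have h1 : W * ((27 : ℝ) ^ 5 * (ε / B ^ 2)) ≤ W * ((27 : ℝ) ^ 5 * (ε / B ^ 2)) * ĉ := le_mul_of_one_le_right (by positivity) hĉ1
    linarith
  · -- the law part: `W·27⁵·ĉ·A/(1−r) = 2Y/Q′`
    have hlaw : W * (27 : ℝ) ^ 5 * ĉ * (A / (1 - (Real.sqrt 2 ^ d)⁻¹)) = 2 * Y / Q' := by
      have hr' : (1 - (Real.sqrt 2 ^ d)⁻¹) ≠ 0 := hr.ne'
      have h1 : 2 * Y * (1 - (Real.sqrt 2 ^ d)⁻¹) / (W * (27 : ℝ) ^ 5 * ĉ * Q') / (1 - (Real.sqrt 2 ^ d)⁻¹) =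
          2 * Y / (W * (27 : ℝ) ^ 5 * ĉ * Q') := by
        rw [div_eq_iff hr']; ring
      rw [hA, h1]
      field_simp
    have hbr : 0 ≤ ε / B ^ 2 + A / (1 - (Real.sqrt 2 ^ d)⁻¹) := by positivity
    calc W * ((27 : ℝ) ^ 5 * (C₁ / C₂) * (8 : ℝ) ^ (d - 1) * (ε / B ^ 2 + A / (1 - (Real.sqrt 2 ^ d)⁻¹)))
        = (C₁ / C₂ * (8 : ℝ) ^ (d - 1)) * (W * (27 : ℝ) ^ 5 * (ε / B ^ 2 + A / (1 - (Real.sqrt 2 ^ d)⁻¹))) := by ring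
      _ ≤ ĉ * (W * (27 : ℝ) ^ 5 * (ε / B ^ 2 + A / (1 - (Real.sqrt 2 ^ d)⁻¹))) := mul_le_mul_of_nonneg_right hĉge (by positivity)
      _ = W * ((27 : ℝ) ^ 5 * (ε / B ^ 2)) * ĉ + W * (27 : ℝ) ^ 5 * ĉ * (A / (1 - (Real.sqrt 2 ^ d)⁻¹)) := by ring
      _ = A' := by rw [hlaw, hA']

/-- **The `Q′`-floors and the blocking consequences**: `Z·CE/ε² ≤ Q′`, `Z·C₂²(2^{d−1})⁻¹·max Q (CE/ε²) ≤ Q′` (from the blocking row), `4Q′ ≤ Q`,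
`2τψQ′ ≤ Q`. -/
theorem towerLevNumerics_floorsQ
    (hZ : 0 < Z) (hC₂ : 0 < C₂) (hε : 0 < ε) (hCE : 0 ≤ CE)
    (hρ : ρ = max 4 (2 * τ * ψ)) (hQ' : Q' = Z * (CE / ε ^ 2) + 1) (hQ : Q = ρ * Q')
    (hblock : max 1 Z * C₂ ^ 2 * max 4 (2 * τ * ψ) ≤ (2 : ℝ) ^ (d - 1)) :
    Z * (CE / ε ^ 2) ≤ Q' ∧ Z * (C₂ ^ 2 * ((2 : ℝ) ^ (d - 1))⁻¹ * max Q (CE / ε ^ 2)) ≤ Q' ∧ 4 * Q' ≤ Q ∧ 2 * τ * ψ * Q' ≤ Q := by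
  have hρ4 : 4 ≤ ρ := by rw [hρ]; exact le_max_left _ _
  have hρτψ : 2 * τ * ψ ≤ ρ := by rw [hρ]; exact le_max_right _ _
  have hρ0 : 0 < ρ := lt_of_lt_of_le (by norm_num) hρ4
  have hQ'0 : 0 < Q' := lt_of_lt_of_le one_pos (towerLevNumerics_one_le_Q' hZ hε hCE hQ')
  have h2d : 0 < (2 : ℝ) ^ (d - 1) := by positivity
  have hF3 : Z * (CE / ε ^ 2) ≤ Q' := by rw [hQ']; linarith
  have hb1 : Z * C₂ ^ 2 * ρ ≤ (2 : ℝ) ^ (d - 1) := by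
    calc Z * C₂ ^ 2 * ρ ≤ max 1 Z * C₂ ^ 2 * ρ :=
          mul_le_mul_of_nonneg_right (mul_le_mul_of_nonneg_right (le_max_right _ _) (sq_nonneg _)) hρ0.le
      _ = max 1 Z * C₂ ^ 2 * max 4 (2 * τ * ψ) := by rw [hρ]
      _ ≤ (2 : ℝ) ^ (d - 1) := hblock
  have hb2 : C₂ ^ 2 ≤ (2 : ℝ) ^ (d - 1) := by
    have h14 : 1 * C₂ ^ 2 * 4 ≤ max 1 Z * C₂ ^ 2 * max 4 (2 * τ * ψ) :=
      mul_le_mul (mul_le_mul_of_nonneg_right (le_max_left _ _) (sq_nonneg _)) (le_max_left _ _) (by norm_num) (by positivity)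
    nlinarith [sq_nonneg C₂]
  refine ⟨hF3, ?_, ?_, ?_⟩
  · have hsplit : Z * (C₂ ^ 2 * ((2 : ℝ) ^ (d - 1))⁻¹ * max Q (CE / ε ^ 2)) =
        max ((Z * C₂ ^ 2 * ρ) / (2 : ℝ) ^ (d - 1) * Q') ((C₂ ^ 2 / (2 : ℝ) ^ (d - 1)) * (Z * (CE / ε ^ 2))) := by
      rw [mul_max_of_nonneg _ _ (show (0 : ℝ) ≤ C₂ ^ 2 * ((2 : ℝ) ^ (d - 1))⁻¹ by positivity), mul_max_of_nonneg _ _ hZ.le, hQ]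
      congr 1
      · field_simp
      · field_simp
    rw [hsplit]
    refine max_le ?_ ?_
    · have hle1 : (Z * C₂ ^ 2 * ρ) / (2 : ℝ) ^ (d - 1) ≤ 1 := (div_le_one h2d).2 hb1
      calc (Z * C₂ ^ 2 * ρ) / (2 : ℝ) ^ (d - 1) * Q' ≤ 1 * Q' := mul_le_mul_of_nonneg_right hle1 hQ'0.le
        _ = Q' := one_mul _
    · have hle1 : C₂ ^ 2 / (2 : ℝ) ^ (d - 1) ≤ 1 := (div_le_one h2d).2 hb2
      calc (C₂ ^ 2 / (2 : ℝ) ^ (d - 1)) * (Z * (CE / ε ^ 2)) ≤ 1 * (Z * (CE / ε ^ 2)) :=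
            mul_le_mul_of_nonneg_right hle1 (by positivity)
        _ = Z * (CE / ε ^ 2) := one_mul _
        _ ≤ Q' := hF3
  · rw [hQ]; exact mul_le_mul_of_nonneg_right hρ4 hQ'0.le
  · rw [hQ]; exact mul_le_mul_of_nonneg_right hρτψ hQ'0.le

/-- **The λ-free part of the kit's `Y` is `2Y`**: `ι₂/(2Q′) + ι₃/(4Q′²) + A′Q′/4 = 2·Y`. -/
theorem towerLevNumerics_Y₀_eq
    (hZ : 0 < Z) (hε : 0 < ε) (hCE : 0 ≤ CE) (hB : 1 ≤ B)
    (hQ' : Q' = Z * (CE / ε ^ 2) + 1)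
    (hY : Y = ι₂ / (2 * Q') + W * Z ^ 3 * X / (4 * Q' ^ 2) + W * ((27 : ℝ) ^ 5 * (ε / B ^ 2)) * ĉ * Q' / 2)
    (hA' : A' = W * ((27 : ℝ) ^ 5 * (ε / B ^ 2)) * ĉ + 2 * Y / Q') (hι₃ : ι₃ = W * Z ^ 3 * X + A' * Q' ^ 3) :
    ι₂ / (2 * Q') + ι₃ / (4 * Q' ^ 2) + A' * Q' / 4 = 2 * Y := by
  have hQ'0 : 0 < Q' := lt_of_lt_of_le one_pos (towerLevNumerics_one_le_Q' hZ hε hCE hQ')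
  have hB0 : 0 < B := lt_of_lt_of_le one_pos hB
  have h1 : ι₃ / (4 * Q' ^ 2) = W * Z ^ 3 * X / (4 * Q' ^ 2) + A' * Q' / 4 := by
    rw [hι₃]; field_simp
  have h2 : A' * Q' / 2 = W * ((27 : ℝ) ^ 5 * (ε / B ^ 2)) * ĉ * Q' / 2 + Y := by
    rw [hA']; field_simp
  calc ι₂ / (2 * Q') + ι₃ / (4 * Q' ^ 2) + A' * Q' / 4
      = ι₂ / (2 * Q') + W * Z ^ 3 * X / (4 * Q' ^ 2) + A' * Q' / 2 := by rw [h1]; ring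
    _ = (ι₂ / (2 * Q') + W * Z ^ 3 * X / (4 * Q' ^ 2) + W * ((27 : ℝ) ^ 5 * (ε / B ^ 2)) * ĉ * Q' / 2) + Y := by rw [h2]; ring
    _ = 2 * Y := by rw [← hY]; ring

/-- **The amplitude rows `(N1) (N2)`** from `8·Φ·τ·Y ≤ 1` and `128·e·ψ³·τ⁴·Φ·(W·27⁵·ĉ)·Y ≤ (1−(√2^d)⁻¹)·ρ³`. -/
theorem towerLevNumerics_N1N2
    (hW : 0 < W) (hZ : 0 < Z) (hC₁ : 0 < C₁) (hC₂ : 0 < C₂) (hd : 2 ≤ d)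
    (hε : 0 < ε) (hCE : 0 ≤ CE) (hB : 1 ≤ B) (hι₂ : 0 ≤ ι₂) (hX : 0 ≤ X)
    (hρ : ρ = max 4 (2 * τ * ψ)) (hQ' : Q' = Z * (CE / ε ^ 2) + 1) (hQ : Q = ρ * Q') (hĉ : ĉ = 1 + C₁ / C₂ * (8 : ℝ) ^ (d - 1))
    (hY : Y = ι₂ / (2 * Q') + W * Z ^ 3 * X / (4 * Q' ^ 2) + W * ((27 : ℝ) ^ 5 * (ε / B ^ 2)) * ĉ * Q' / 2)
    (hA : A = 2 * Y * (1 - (Real.sqrt 2 ^ d)⁻¹) / (W * (27 : ℝ) ^ 5 * ĉ * Q'))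
    (hA' : A' = W * ((27 : ℝ) ^ 5 * (ε / B ^ 2)) * ĉ + 2 * Y / Q') (hι₃ : ι₃ = W * Z ^ 3 * X + A' * Q' ^ 3)
    (amp1 : 8 * Φ * τ * Y ≤ 1)
    (amp2 : 128 * exp 1 * ψ ^ 3 * τ ^ 4 * Φ * (W * (27 : ℝ) ^ 5 * ĉ) * Y ≤ (1 - (Real.sqrt 2 ^ d)⁻¹) * ρ ^ 3) :
    Φ * (τ * (ι₂ / (2 * Q') + ι₃ / (4 * Q' ^ 2) + A' * Q' / 4)) ≤ 1 / 4 ∧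
      16 * exp 1 * ψ * (2 * τ * ψ * Q') ^ 2 * Φ * τ ^ 2 * (ι₂ / (2 * Q') + ι₃ / (4 * Q' ^ 2) + A' * Q' / 4) ^ 2 ≤ A * Q ^ 3 := by
  obtain ⟨hY0, hQ'0, _, _, _, _, _⟩ := towerLevNumerics_pos hW hZ hC₁ hC₂ hd hε hCE hB hι₂ hX hρ hQ' hQ hĉ hY hA hA' hι₃
  have hr : 0 < 1 - (Real.sqrt 2 ^ d)⁻¹ := one_sub_inv_sqrt_two_pow_pos (by omega)
  have hĉ0 : 0 < ĉ := lt_of_lt_of_le one_pos (towerLevNumerics_chat hC₁ hC₂ hĉ (d := d)).1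
  have hK0 : 0 < W * (27 : ℝ) ^ 5 * ĉ := by positivity
  have hY₀ := towerLevNumerics_Y₀_eq (ι₂ := ι₂) (X := X) hZ hε hCE hB hQ' hY hA' hι₃
  rw [hY₀]
  constructor
  · nlinarith [amp1]
  · have hAQ3 : A * Q ^ 3 = (2 * Y * Q' ^ 2) * ((1 - (Real.sqrt 2 ^ d)⁻¹) * ρ ^ 3 / (W * (27 : ℝ) ^ 5 * ĉ)) := by
      rw [hA, hQ]; field_simp
    have hlhs : 16 * exp 1 * ψ * (2 * τ * ψ * Q') ^ 2 * Φ * τ ^ 2 * (2 * Y) ^ 2 =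
        (2 * Y * Q' ^ 2) * (128 * exp 1 * ψ ^ 3 * τ ^ 4 * Φ * Y) := by ring
    rw [hAQ3, hlhs]
    refine mul_le_mul_of_nonneg_left ?_ (by positivity)
    rw [le_div_iff₀ hK0]
    calc 128 * exp 1 * ψ ^ 3 * τ ^ 4 * Φ * Y * (W * (27 : ℝ) ^ 5 * ĉ)
        = 128 * exp 1 * ψ ^ 3 * τ ^ 4 * Φ * (W * (27 : ℝ) ^ 5 * ĉ) * Y := by ring
      _ ≤ (1 - (Real.sqrt 2 ^ d)⁻¹) * ρ ^ 3 := amp2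

/-- **THE (I5)-LEV ROWS.**  With the explicit choices of the module docstring (equational binders), the blocking row and the two amplitude rows:
positivity of `Q′, Q, A, A·Q³`, nonnegativity of `A′, ι₃`; the six floors of `klTowerBLev_le_law_of_inputs_scaled_disc`; `hu₁`, `hu₂`; and the λ-free amplitude
rows `(N1) (N2)` of `towerNumerics_side_of_rows` (the λ-free part of the kit's `Y` is `2Y`). -/
theorem towerLevNumerics_rows
    (hW : 0 < W) (hZ : 0 < Z) (hC₁ : 0 < C₁) (hC₂ : 0 < C₂) (hd : 2 ≤ d)
    (hε : 0 < ε) (hCE : 0 ≤ CE) (hB : 1 ≤ B) (hι₂ : 0 ≤ ι₂) (hX : 0 ≤ X)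
    (hρ : ρ = max 4 (2 * τ * ψ)) (hQ' : Q' = Z * (CE / ε ^ 2) + 1) (hQ : Q = ρ * Q') (hĉ : ĉ = 1 + C₁ / C₂ * (8 : ℝ) ^ (d - 1))
    (hY : Y = ι₂ / (2 * Q') + W * Z ^ 3 * X / (4 * Q' ^ 2) + W * ((27 : ℝ) ^ 5 * (ε / B ^ 2)) * ĉ * Q' / 2)
    (hA : A = 2 * Y * (1 - (Real.sqrt 2 ^ d)⁻¹) / (W * (27 : ℝ) ^ 5 * ĉ * Q'))
    (hA' : A' = W * ((27 : ℝ) ^ 5 * (ε / B ^ 2)) * ĉ + 2 * Y / Q') (hι₃ : ι₃ = W * Z ^ 3 * X + A' * Q' ^ 3)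
    (hblock : max 1 Z * C₂ ^ 2 * max 4 (2 * τ * ψ) ≤ (2 : ℝ) ^ (d - 1))
    (amp1 : 8 * Φ * τ * Y ≤ 1)
    (amp2 : 128 * exp 1 * ψ ^ 3 * τ ^ 4 * Φ * (W * (27 : ℝ) ^ 5 * ĉ) * Y ≤ (1 - (Real.sqrt 2 ^ d)⁻¹) * ρ ^ 3) :
    (0 < Q' ∧ 0 < Q ∧ 0 < A ∧ 0 ≤ A' ∧ 0 ≤ ι₃ ∧ 0 < A * Q ^ 3) ∧
    (W * ((27 : ℝ) ^ 5 * (ε / B ^ 2)) ≤ A' ∧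
      W * ((27 : ℝ) ^ 5 * (C₁ / C₂) * (8 : ℝ) ^ (d - 1) * (ε / B ^ 2 + A / (1 - (Real.sqrt 2 ^ d)⁻¹))) ≤ A' ∧
      Z * (CE / ε ^ 2) ≤ Q' ∧ Z * (C₂ ^ 2 * ((2 : ℝ) ^ (d - 1))⁻¹ * max Q (CE / ε ^ 2)) ≤ Q' ∧
      W * Z ^ 3 * X ≤ ι₃ ∧ A' * Q' ^ 3 ≤ ι₃) ∧
    (4 * Q' ≤ Q ∧ 2 * τ * ψ * Q' ≤ Q) ∧
    (Φ * (τ * (ι₂ / (2 * Q') + ι₃ / (4 * Q' ^ 2) + A' * Q' / 4)) ≤ 1 / 4 ∧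
      16 * exp 1 * ψ * (2 * τ * ψ * Q') ^ 2 * Φ * τ ^ 2 * (ι₂ / (2 * Q') + ι₃ / (4 * Q' ^ 2) + A' * Q' / 4) ^ 2 ≤ A * Q ^ 3) := by
  obtain ⟨_, hQ'0, hQ0, hA0, hA'0, hι₃0, hAQ⟩ := towerLevNumerics_pos hW hZ hC₁ hC₂ hd hε hCE hB hι₂ hX hρ hQ' hQ hĉ hY hA hA' hι₃
  obtain ⟨hF1, hF2⟩ := towerLevNumerics_floorsA hW hZ hC₁ hC₂ hd hε hCE hB hι₂ hX hρ hQ' hQ hĉ hY hA hA' hι₃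
  obtain ⟨hF3, hF4, hu₁, hu₂⟩ := towerLevNumerics_floorsQ (d := d) hZ hC₂ hε hCE hρ hQ' hQ hblock
  obtain ⟨N1, N2⟩ := towerLevNumerics_N1N2 hW hZ hC₁ hC₂ hd hε hCE hB hι₂ hX hρ hQ' hQ hĉ hY hA hA' hι₃ amp1 amp2
  have hF6 : W * Z ^ 3 * X ≤ ι₃ := by rw [hι₃]; linarith [show (0 : ℝ) ≤ A' * Q' ^ 3 by positivity]
  have hF7 : A' * Q' ^ 3 ≤ ι₃ := by rw [hι₃]; linarith [show (0 : ℝ) ≤ W * Z ^ 3 * X by positivity]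
  exact ⟨⟨hQ'0, hQ0, hA0, hA'0, hι₃0, hAQ⟩, ⟨hF1, hF2, hF3, hF4, hF6, hF7⟩, ⟨hu₁, hu₂⟩, N1, N2⟩

end Rows

/-! ## §3 All numerical hypotheses of the levelled law at once: from `λ ≤ λ₀`, and from the two doors -/

section All

variable {σ Φ ψ τ W Z C₁ C₂ ε CE B ι₁ ι₂ X ρ Q' Q ĉ Y A A' ι₃ lam : ℝ} {d : ℕ}

/-- **(I5)-LEV FROM `λ ≤ λ₀`.**  Under the choices/rows of `towerLevNumerics_rows` and `0 ≤ λ ≤ λ₀` (`λ₀` = the seven-entry `min`-chain of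
`towerNumerics_side_of_lam_le` at the chosen `(Q′, Q, A′, A, ι₃)`; positive by `towerNumerics_threshold_pos`): the kit's six λ-dependent side conditions
`hx₁ hx₂ hx₃ hy hθ hclose` of `klTowerBLev_le_law_of_inputs_scaled_disc`, token-for-token (the floors and `hu₁ hu₂` are `towerLevNumerics_rows`). -/
theorem towerLevNumerics_side_of_lam_le
    (hσ : 0 ≤ σ) (hΦ : 0 ≤ Φ) (hψ : 0 ≤ ψ) (hτ : 0 < τ) (hW : 0 < W) (hZ : 0 < Z) (hC₁ : 0 < C₁) (hC₂ : 0 < C₂) (hd : 2 ≤ d)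
    (hε : 0 < ε) (hCE : 0 ≤ CE) (hB : 1 ≤ B) (hι₁ : 0 ≤ ι₁) (hι₂ : 0 ≤ ι₂) (hX : 0 ≤ X)
    (hρ : ρ = max 4 (2 * τ * ψ)) (hQ' : Q' = Z * (CE / ε ^ 2) + 1) (hQ : Q = ρ * Q') (hĉ : ĉ = 1 + C₁ / C₂ * (8 : ℝ) ^ (d - 1))
    (hY : Y = ι₂ / (2 * Q') + W * Z ^ 3 * X / (4 * Q' ^ 2) + W * ((27 : ℝ) ^ 5 * (ε / B ^ 2)) * ĉ * Q' / 2)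
    (hA : A = 2 * Y * (1 - (Real.sqrt 2 ^ d)⁻¹) / (W * (27 : ℝ) ^ 5 * ĉ * Q'))
    (hA' : A' = W * ((27 : ℝ) ^ 5 * (ε / B ^ 2)) * ĉ + 2 * Y / Q') (hι₃ : ι₃ = W * Z ^ 3 * X + A' * Q' ^ 3)
    (hblock : max 1 Z * C₂ ^ 2 * max 4 (2 * τ * ψ) ≤ (2 : ℝ) ^ (d - 1))
    (amp1 : 8 * Φ * τ * Y ≤ 1)
    (amp2 : 128 * exp 1 * ψ ^ 3 * τ ^ 4 * Φ * (W * (27 : ℝ) ^ 5 * ĉ) * Y ≤ (1 - (Real.sqrt 2 ^ d)⁻¹) * ρ ^ 3)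
    (hlam : 0 ≤ lam)
    (hle : lam ≤ min 1 (min (1 / (8 * σ * Q' + 1)) (min (1 / (2 * exp 1 * τ * Q' + 1)) (min (1 / (4 * Φ * τ * ι₁ + 1))
      (min (1 / (2 * (Φ * (exp 1 * τ * ι₁ + (exp 1 * τ) ^ 2 * ι₂ + (exp 1 * τ) ^ 3 * ι₃ + A' * (exp 1 * τ * Q') ^ 2 / 2)) + 1))
        (min (A * Q ^ 3 / (16 * σ * Q' * A' * (4 * Q') ^ 3 + A * Q ^ 3))
          (A * Q ^ 3 / (16 * exp 1 * ψ * (2 * τ * ψ * Q') ^ 2 * Φ * τ ^ 2 * ι₁ ^ 2 + A * Q ^ 3)))))))) :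
    4 * σ * lam * Q' < 1 ∧ 2 * lam * τ * Q' ≤ 1 ∧ exp 1 * τ * lam * Q' < 1 ∧
      Φ * (τ * (ι₁ * lam + ι₂ / (2 * Q') + ι₃ / (4 * Q' ^ 2) + A' * Q' / 4)) < 1 ∧
      Φ * (exp 1 * τ * (ι₁ * lam) + (exp 1 * τ) ^ 2 * (ι₂ * lam) + (exp 1 * τ) ^ 3 * (ι₃ * lam ^ 2) +
        A' * (exp 1 * τ * Q') * ((exp 1 * τ * lam * Q') ^ 3 / (1 - exp 1 * τ * lam * Q'))) < 1 ∧
      A' * (4 * Q') ^ 3 * (4 * σ * lam * Q' / (1 - 4 * σ * lam * Q')) +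
        exp 1 * ψ * (2 * τ * ψ * Q') ^ 2 * (τ * (ι₁ * lam + ι₂ / (2 * Q') + ι₃ / (4 * Q' ^ 2) + A' * Q' / 4)) *
          (Φ * (τ * (ι₁ * lam + ι₂ / (2 * Q') + ι₃ / (4 * Q' ^ 2) + A' * Q' / 4)) /
            (1 - Φ * (τ * (ι₁ * lam + ι₂ / (2 * Q') + ι₃ / (4 * Q' ^ 2) + A' * Q' / 4)))) ≤ A * Q ^ 3 := by
  obtain ⟨⟨hQ'0, _, _, hA'0, hι₃0, hAQ⟩, _, _, N1, N2⟩ :=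
    towerLevNumerics_rows hW hZ hC₁ hC₂ hd hε hCE hB hι₂ hX hρ hQ' hQ hĉ hY hA hA' hι₃ hblock amp1 amp2
  exact towerNumerics_side_of_lam_le hσ hΦ hψ hτ.le hA'0 hQ'0.le hι₁ hι₂ hι₃0 hAQ hlam hle N1 N2

/-- **(I5)-LEV FROM THE TWO DOORS** (KL regime, `λ := B′·epsCoupling P U j`, any `B′ ≥ 0`): under the choices/rows of `towerLevNumerics_rows`, the U-door
`U ≤ λ₀/(2·B′·Klam + 1)` and the c-door `cc ≤ λ₀·log 4/(2·B′·Klam + 1)` with `IsKLRegime U cc (−n)`, `j ≤ n`: the kit's six λ-dependent side conditions at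
`λ = B′·epsCoupling P U j` (`towerNumerics_side_of_doors`). -/
theorem towerLevNumerics_side_of_doors {P : SplitConsts} {U cc B' : ℝ} {n j : ℕ}
    (hK : 0 ≤ P.Klam) (hσ : 0 ≤ σ) (hΦ : 0 ≤ Φ) (hψ : 0 ≤ ψ) (hτ : 0 < τ) (hW : 0 < W) (hZ : 0 < Z) (hC₁ : 0 < C₁) (hC₂ : 0 < C₂)
    (hd : 2 ≤ d) (hε : 0 < ε) (hCE : 0 ≤ CE) (hB : 1 ≤ B) (hι₁ : 0 ≤ ι₁) (hι₂ : 0 ≤ ι₂) (hX : 0 ≤ X) (hB' : 0 ≤ B') (hU : 0 ≤ U)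
    (hreg : IsKLRegime U cc (-(n : ℤ))) (hj : j ≤ n)
    (hρ : ρ = max 4 (2 * τ * ψ)) (hQ' : Q' = Z * (CE / ε ^ 2) + 1) (hQ : Q = ρ * Q') (hĉ : ĉ = 1 + C₁ / C₂ * (8 : ℝ) ^ (d - 1))
    (hY : Y = ι₂ / (2 * Q') + W * Z ^ 3 * X / (4 * Q' ^ 2) + W * ((27 : ℝ) ^ 5 * (ε / B ^ 2)) * ĉ * Q' / 2)
    (hA : A = 2 * Y * (1 - (Real.sqrt 2 ^ d)⁻¹) / (W * (27 : ℝ) ^ 5 * ĉ * Q'))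
    (hA' : A' = W * ((27 : ℝ) ^ 5 * (ε / B ^ 2)) * ĉ + 2 * Y / Q') (hι₃ : ι₃ = W * Z ^ 3 * X + A' * Q' ^ 3)
    (hblock : max 1 Z * C₂ ^ 2 * max 4 (2 * τ * ψ) ≤ (2 : ℝ) ^ (d - 1))
    (amp1 : 8 * Φ * τ * Y ≤ 1)
    (amp2 : 128 * exp 1 * ψ ^ 3 * τ ^ 4 * Φ * (W * (27 : ℝ) ^ 5 * ĉ) * Y ≤ (1 - (Real.sqrt 2 ^ d)⁻¹) * ρ ^ 3)
    (hUdoor : U ≤ min 1 (min (1 / (8 * σ * Q' + 1)) (min (1 / (2 * exp 1 * τ * Q' + 1)) (min (1 / (4 * Φ * τ * ι₁ + 1))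
      (min (1 / (2 * (Φ * (exp 1 * τ * ι₁ + (exp 1 * τ) ^ 2 * ι₂ + (exp 1 * τ) ^ 3 * ι₃ + A' * (exp 1 * τ * Q') ^ 2 / 2)) + 1))
        (min (A * Q ^ 3 / (16 * σ * Q' * A' * (4 * Q') ^ 3 + A * Q ^ 3))
          (A * Q ^ 3 / (16 * exp 1 * ψ * (2 * τ * ψ * Q') ^ 2 * Φ * τ ^ 2 * ι₁ ^ 2 + A * Q ^ 3))))))) / (2 * B' * P.Klam + 1))
    (hcdoor : cc ≤ min 1 (min (1 / (8 * σ * Q' + 1)) (min (1 / (2 * exp 1 * τ * Q' + 1)) (min (1 / (4 * Φ * τ * ι₁ + 1))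
      (min (1 / (2 * (Φ * (exp 1 * τ * ι₁ + (exp 1 * τ) ^ 2 * ι₂ + (exp 1 * τ) ^ 3 * ι₃ + A' * (exp 1 * τ * Q') ^ 2 / 2)) + 1))
        (min (A * Q ^ 3 / (16 * σ * Q' * A' * (4 * Q') ^ 3 + A * Q ^ 3))
          (A * Q ^ 3 / (16 * exp 1 * ψ * (2 * τ * ψ * Q') ^ 2 * Φ * τ ^ 2 * ι₁ ^ 2 + A * Q ^ 3))))))) * Real.log 4 / (2 * B' * P.Klam + 1)) :
    4 * σ * (B' * epsCoupling P U j) * Q' < 1 ∧ 2 * (B' * epsCoupling P U j) * τ * Q' ≤ 1 ∧ exp 1 * τ * (B' * epsCoupling P U j) * Q' < 1 ∧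
      Φ * (τ * (ι₁ * (B' * epsCoupling P U j) + ι₂ / (2 * Q') + ι₃ / (4 * Q' ^ 2) + A' * Q' / 4)) < 1 ∧
      Φ * (exp 1 * τ * (ι₁ * (B' * epsCoupling P U j)) + (exp 1 * τ) ^ 2 * (ι₂ * (B' * epsCoupling P U j)) +
        (exp 1 * τ) ^ 3 * (ι₃ * (B' * epsCoupling P U j) ^ 2) +
        A' * (exp 1 * τ * Q') * ((exp 1 * τ * (B' * epsCoupling P U j) * Q') ^ 3 / (1 - exp 1 * τ * (B' * epsCoupling P U j) * Q'))) < 1 ∧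
      A' * (4 * Q') ^ 3 * (4 * σ * (B' * epsCoupling P U j) * Q' / (1 - 4 * σ * (B' * epsCoupling P U j) * Q')) +
        exp 1 * ψ * (2 * τ * ψ * Q') ^ 2 * (τ * (ι₁ * (B' * epsCoupling P U j) + ι₂ / (2 * Q') + ι₃ / (4 * Q' ^ 2) + A' * Q' / 4)) *
          (Φ * (τ * (ι₁ * (B' * epsCoupling P U j) + ι₂ / (2 * Q') + ι₃ / (4 * Q' ^ 2) + A' * Q' / 4)) /
            (1 - Φ * (τ * (ι₁ * (B' * epsCoupling P U j) + ι₂ / (2 * Q') + ι₃ / (4 * Q' ^ 2) + A' * Q' / 4)))) ≤ A * Q ^ 3 := by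
  obtain ⟨⟨hQ'0, _, _, hA'0, hι₃0, hAQ⟩, _, _, N1, N2⟩ :=
    towerLevNumerics_rows hW hZ hC₁ hC₂ hd hε hCE hB hι₂ hX hρ hQ' hQ hĉ hY hA hA' hι₃ hblock amp1 amp2
  exact towerNumerics_side_of_doors hK hσ hΦ hψ hτ.le hA'0 hQ'0.le hι₁ hι₂ hι₃0 hAQ hB' hU hreg hj N1 N2 hUdoor hcdoor

end All

end Summit.HubbardSuperconductivity.HubbardSuperconductivity.Theorems.EngineV8

end
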